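/-
Copyright (c) 2026. All rights reserved.
Released under Apache 2.0 license as described in the file LICENSE.
Authors: abc-iut cell, statement-typer seat abc-iut-L4-t3 (wave 1; gen 6).
-/
import Literature.AnabelianGeometry.AbsoluteAnabelian.LogFrobeniusMonoTelecoreContact
import HarnessLib

/-!
# [AbsTopIII] Corollary 5.10 (iv)(b)(c): the PINNED row holds at the tagged calibration setting — so pinned ⇏ typed (abc-iut-f-101's R4)

S. Mochizuki, *Topics in absolute anabelian geometry III: global reconstruction algorithms*,
J. Math. Sci. Univ. Tokyo 22 (2015) 939–1156 [MochizukiAbsTopIII2015]; manuscript (`paper:url-5493eb38cbb7`) Cor 5.10 (iv)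
(b)(c) pp. 147–148.

PROOF-ONLY.  With abc-iut-f-101 g3's sufficiency `MonoTelecoreCoherence.cor510MonoTelecorePinned` (R3, p463433:
`LogFrobeniusMonoTelecoreContact`) and this seat's
tagged add-on data (`taggedMonoHomotopies`, `taggedMonoTelecoreCoherence`): the print-faithful row `Cor510MonoTelecorePinned`
HOLDS at abc-iut-f-101 g2's tagged setting, where the frozen typed row `Cor510MonoTelecore` (F-0139) FAILS
(`not_cor510MonoTelecore_tagged`) — the kernel separation «pinned ⇏ typed» completing «typed ⇒ pinned»
(`cor510MonoTelecorePinned_of_cor510MonoTelecore`).  DEGENERATE calibration setting; nothing about print impugned.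
-/

set_option autoImplicit false

universe u

open CategoryTheory

namespace Literature.AnabelianGeometry.AbsoluteAnabelian

namespace LogFrobeniusSetting

variable (Vmod : Type u) (isArc : Vmod → Bool)

/-- **The pinned row holds at the tagged setting** (every printed datum present: (a)(c)(d) + coherence by identities).
[cite: MochizukiAbsTopIII2015, Cor 5.10 (iv)(c) p.148] -/
theorem tagged_cor510MonoTelecorePinned [Nonempty Vmod] (C : Type (u + 1)) [Category.{u} C] :
    (tagged Vmod isArc C).Cor510MonoTelecorePinned :=
  (taggedMonoTelecoreCoherence Vmod isArc C).cor510MonoTelecorePinned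

/-- **Pinned ⇏ typed**: over every index set with a nonarchimedean place there is a setting satisfying the print-faithful
row and violating the frozen typed row F-0139. [cite: MochizukiAbsTopIII2015, Cor 5.10 (iv)(c) p.148] -/
theorem exists_cor510MonoTelecorePinned_not_cor510MonoTelecore (v₀ : Vmod) (hv₀ : isArc v₀ = false) :
    ∃ L : LogFrobeniusSetting Vmod isArc, L.Cor510MonoTelecorePinned ∧ ¬ L.Cor510MonoTelecore := by
  haveI : Nonempty Vmod := ⟨v₀⟩
  exact ⟨tagged Vmod isArc (Type u), tagged_cor510MonoTelecorePinned Vmod isArc (Type u),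
    not_cor510MonoTelecore_tagged Vmod isArc (Type u) PUnit v₀ hv₀⟩

/-- Hence the converse of `cor510MonoTelecorePinned_of_cor510MonoTelecore` FAILS in general.
[cite: MochizukiAbsTopIII2015, Cor 5.10 (iv)(c) p.148] -/
theorem not_forall_cor510MonoTelecore_of_pinned (v₀ : Vmod) (hv₀ : isArc v₀ = false) :
    ¬ ∀ L : LogFrobeniusSetting Vmod isArc, L.Cor510MonoTelecorePinned → L.Cor510MonoTelecore := by
  intro h
  obtain ⟨L, hP, hT⟩ := exists_cor510MonoTelecorePinned_not_cor510MonoTelecore Vmod isArc v₀ hv₀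
  exact hT (h L hP)

end LogFrobeniusSetting

end Literature.AnabelianGeometry.AbsoluteAnabelian
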